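import Mathlib
import Literature.Analysis.FluidPDE.MollifiedField
import Literature.Analysis.FluidPDE.DecayingScalarIntegrationByParts
import Literature.Analysis.FluidPDE.WeakGradientIBP
import Literature.Analysis.FunctionSpaces.MollificationLocal
import Literature.Analysis.FunctionSpaces.MollificationLp
import Literature.Analysis.FunctionSpaces.Mollification
import HarnessLib

/-!
# Profile local energy equality, I: tools
# (crux `EulerZoomLiouville.PowerGaugeEulerLiouville` = stmt-NavierStokesRegularity-19832, line `birth`, rung C1)

Route `EulerZoomLiouville` (NavierStokesRegularity).  Tools for the velocity-testing of the weak self-similar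
Euler profile equation (`…ProfileEnergyEquality.lean`): Hölder exponent bookkeeping (`(3,3,3/2)`, `(2,6,3/2)`),
`‖|V|²‖_{3/2} = ‖V‖₃²`; INTERIOR MOLLIFICATION of the truncated profile `ρ ⋆ 𝟙_{B(0,R+2)}V`
(local agreement with `ρ ⋆ V` on `B(0,R+1)`, hence divergence free there for a weakly divergence-free `V`,
`divergence_normed_convolution_indicator_eq_zero`; interior `L²` bound of its derivative by `‖G‖_{L²(B(0,R+2))}`);
pointwise calculus (`D(σW)`, `div(σW) = Dσ(W) + σ div W`, `D(½σ|W|²)`), measurability and an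
integrability criterion from a bound on the support.

Context.  An EXACTLY SELF-SIMILAR member `u(t,x) = (−t)^{γ−1} V(x/(−t)^γ)`, `p = (−t)^{2(γ−1)} P(x/(−t)^γ)`
(`γ = 1/(2+ρ)`) of Seregin's power-gauged ancient Euler class (the crux, stmt-NavierStokesRegularity-19832) has an
`H¹_loc` profile (`E`-gauge) with `P ∈ L^{3/2}_loc` (`D`-gauge) solving the profile equation
`(1−γ)V + γ(y·∇)V + (V·∇)V + ∇P = 0` weakly.  The lineage's profile dictionary transfers the local energy
INEQUALITY only (`selfSimilar_profile_energy_le_add_flux`); critic-2's K3 (the NSI cascade) shows the open core of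
the crux needs a lever that USES THE EULER IDENTITY.  This chain of files supplies the first such lever on rung C1:
velocity-testing the weak profile equation (legitimate for `H¹_loc` profiles because the equation is steady-type:
`H¹_loc ⊂ L⁶_loc` closes the trilinear term; Chae–Shvydkoy 2013 §2.2 ASSUME `C¹_loc` for the local energy equality)
gives the profile LOCAL ENERGY EQUALITY `(2 − 5γ)∫σ|V|² = ∫(|V|²+2P)⟪V,∇σ⟫ + γ∫|V|²⟪y,∇σ⟫`.
WHAT THIS IS NOT: not NS regularity, not the crux — a C1 tool, `--supports` stmt-19832. [folklore]
-/

noncomputable section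

set_option linter.dupNamespace false

open MeasureTheory Set Filter Topology Metric Function TopologicalSpace
open scoped ENNReal NNReal RealInnerProductSpace ContDiff Convolution

namespace Summit.NavierStokesRegularity.NavierStokesRegularity.Theorems.PowerGaugeEulerLiouville

open Literature.Analysis Literature.Analysis.FunctionSpaces Literature.Analysis.FluidPDE

namespace ProfileEnergy

/-! ## Hölder pairings `L^{3/2} × L³` -/

/-- `1/3 + 1/3 = 1/(3/2)`. [folklore] -/
theorem holderTriple_three_three_threeHalves : ENNReal.HolderTriple 3 3 (3 / 2 : ℝ≥0∞) := by
  refine ⟨?_⟩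
  rw [ENNReal.inv_div (Or.inr (by norm_num)) (Or.inr (by norm_num))]
  have e3 : (3 : ℝ≥0∞)⁻¹ = ((3⁻¹ : ℝ≥0) : ℝ≥0∞) := by rw [ENNReal.coe_inv (by norm_num)]; norm_num
  have e23 : (2 / 3 : ℝ≥0∞) = ((2 / 3 : ℝ≥0) : ℝ≥0∞) := by rw [ENNReal.coe_div (by norm_num)]; norm_num
  rw [e3, e23, ← ENNReal.coe_add, ENNReal.coe_inj]
  norm_num

/-- `1/2 + 1/6 = 1/(3/2)`. [folklore] -/
theorem holderTriple_two_six_threeHalves : ENNReal.HolderTriple 2 6 (3 / 2 : ℝ≥0∞) := by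
  refine ⟨?_⟩
  rw [ENNReal.inv_div (Or.inr (by norm_num)) (Or.inr (by norm_num))]
  have e2 : (2 : ℝ≥0∞)⁻¹ = ((2⁻¹ : ℝ≥0) : ℝ≥0∞) := by rw [ENNReal.coe_inv (by norm_num)]; norm_num
  have e6 : (6 : ℝ≥0∞)⁻¹ = ((6⁻¹ : ℝ≥0) : ℝ≥0∞) := by rw [ENNReal.coe_inv (by norm_num)]; norm_num
  have e23 : (2 / 3 : ℝ≥0∞) = ((2 / 3 : ℝ≥0) : ℝ≥0∞) := by rw [ENNReal.coe_div (by norm_num)]; norm_num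
  rw [e2, e6, e23, ← ENNReal.coe_add, ENNReal.coe_inj]
  norm_num

/-- `eLpNorm` of a constant multiple of a real function. [folklore] -/
theorem eLpNorm_const_mul' {α : Type*} [MeasurableSpace α] (μ : Measure α) (c : ℝ) (g : α → ℝ) (p : ℝ≥0∞) :
    eLpNorm (fun x => c * g x) p μ = ‖c‖ₑ * eLpNorm g p μ := by
  rw [show (fun x => c * g x) = c • g from rfl, eLpNorm_const_smul]

/-- **Hölder for a product of two real functions built from norms**, exponents `(p, q, 3/2)`. [folklore] -/
theorem eLpNorm_mul_le_threeHalves {f g : EuclideanSpace ℝ (Fin 3) → ℝ} (hf : AEStronglyMeasurable f volume)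
    (hg : AEStronglyMeasurable g volume) (p q : ℝ≥0∞) [ENNReal.HolderTriple p q (3 / 2 : ℝ≥0∞)] :
    eLpNorm (fun x => f x * g x) (3 / 2 : ℝ≥0∞) volume ≤ eLpNorm f p volume * eLpNorm g q volume := by
  have h := eLpNorm_le_eLpNorm_mul_eLpNorm_of_nnnorm (p := p) (q := q) (r := (3 / 2 : ℝ≥0∞)) hf hg
    (fun (a b : ℝ) => a * b) 1 (Eventually.of_forall fun x => by simp [nnnorm_mul])
  rw [ENNReal.coe_one, one_mul] at h
  exact h

/-- `‖ |V|^2 ‖_{3/2} = ‖V‖₃²`. [folklore] -/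
theorem eLpNorm_norm_sq_threeHalves (V : EuclideanSpace ℝ (Fin 3) → EuclideanSpace ℝ (Fin 3)) :
    eLpNorm (fun x => ‖V x‖ ^ 2) (3 / 2 : ℝ≥0∞) volume = eLpNorm V 3 volume ^ 2 := by
  have h := eLpNorm_norm_rpow V (p := (3 / 2 : ℝ≥0∞)) (μ := volume) (q := 2) two_pos
  have e : (3 / 2 : ℝ≥0∞) * ENNReal.ofReal 2 = 3 := by
    rw [ENNReal.ofReal_ofNat, ENNReal.div_mul_cancel (by norm_num) (by norm_num)]
  rw [e] at h
  have h' : (fun x => ‖V x‖ ^ (2 : ℝ)) = fun x => ‖V x‖ ^ 2 := funext fun x => Real.rpow_two _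
  rw [h'] at h
  rw [h, ← ENNReal.rpow_two]

/-- `3/2 ≤ 6` in `ℝ≥0∞`. [folklore] -/
theorem threeHalves_le_six : (3 / 2 : ℝ≥0∞) ≤ 6 := by
  rw [ENNReal.div_le_iff (by norm_num) (by norm_num)]; norm_num


/-! ## Interior mollification of the truncated profile -/

section Mollify

variable {F : Type*} [NormedAddCommGroup F] [NormedSpace ℝ F] [CompleteSpace F]

omit [CompleteSpace F] in
/-- **Local agreement.** For a bump `φ` of outer radius `≤ 1` and `x ∈ B(0, R+1)`, mollifying `f` and
mollifying its truncation `𝟙_{B(0,R+2)} f` give the same value at `x` (the kernel `φ(x − ·)` lives in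
`B(x, 1) ⊆ B(0, R+2)`). [folklore] -/
theorem normed_convolution_indicator_ball_eq (φ : ContDiffBump (0 : EuclideanSpace ℝ (Fin 3)))
    (hφ : φ.rOut ≤ 1) (f : EuclideanSpace ℝ (Fin 3) → F) {R : ℝ} {x : EuclideanSpace ℝ (Fin 3)}
    (hx : x ∈ ball (0 : EuclideanSpace ℝ (Fin 3)) (R + 1)) :
    (φ.normed volume ⋆[ContinuousLinearMap.lsmul ℝ ℝ, volume]
        (ball (0 : EuclideanSpace ℝ (Fin 3)) (R + 2)).indicator f) x =
      (φ.normed volume ⋆[ContinuousLinearMap.lsmul ℝ ℝ, volume] f) x := by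
  rw [convolution_def, convolution_def]
  refine integral_congr_ae (Eventually.of_forall fun t => ?_)
  simp only [ContinuousLinearMap.lsmul_apply]
  by_cases ht : φ.normed volume t = 0
  · simp [ht]
  · have ht' : t ∈ support (φ.normed volume) := ht
    rw [φ.support_normed_eq, mem_ball, dist_zero_right] at ht'
    have hxt : x - t ∈ ball (0 : EuclideanSpace ℝ (Fin 3)) (R + 2) := by
      rw [mem_ball, dist_zero_right] at hx ⊢
      calc ‖x - t‖ ≤ ‖x‖ + ‖t‖ := norm_sub_le x t
        _ < (R + 1) + 1 := by linarith
        _ = R + 2 := by ring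
    rw [indicator_of_mem hxt]

/-- **The interior mollification of a weakly divergence-free field is divergence free in the
interior**: with `W = φ ⋆ 𝟙_{B(0,R+2)} V`, `rOut φ ≤ 1`, `div W = 0` on `B(0, R+1)` (it agrees
near such points with `φ ⋆ V`, which is divergence free everywhere, `divergence_convolution_eq_zero`).
[folklore] -/
theorem divergence_normed_convolution_indicator_eq_zero
    (φ : ContDiffBump (0 : EuclideanSpace ℝ (Fin 3))) (hφ : φ.rOut ≤ 1)
    {V : EuclideanSpace ℝ (Fin 3) → EuclideanSpace ℝ (Fin 3)} (hV : LocallyIntegrable V volume)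
    (hdiv : IsWeaklyDivFree V) {R : ℝ} {x : EuclideanSpace ℝ (Fin 3)}
    (hx : x ∈ ball (0 : EuclideanSpace ℝ (Fin 3)) (R + 1)) :
    VectorCalculus.divergence (φ.normed volume ⋆[ContinuousLinearMap.lsmul ℝ ℝ, volume]
        (ball (0 : EuclideanSpace ℝ (Fin 3)) (R + 2)).indicator V) x = 0 := by
  have hloc : (φ.normed volume ⋆[ContinuousLinearMap.lsmul ℝ ℝ, volume]
        (ball (0 : EuclideanSpace ℝ (Fin 3)) (R + 2)).indicator V) =ᶠ[𝓝 x]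
      (φ.normed volume ⋆[ContinuousLinearMap.lsmul ℝ ℝ, volume] V) := by
    filter_upwards [isOpen_ball.mem_nhds hx] with y hy
    exact normed_convolution_indicator_ball_eq φ hφ V hy
  unfold VectorCalculus.divergence
  rw [hloc.fderiv_eq]
  exact divergence_convolution_eq_zero φ.contDiff_normed φ.hasCompactSupport_normed hV hdiv x

omit [CompleteSpace F] in
/-- The interior mollification is smooth. [folklore] -/
theorem contDiff_normed_convolution_indicator (φ : ContDiffBump (0 : EuclideanSpace ℝ (Fin 3)))
    {f : EuclideanSpace ℝ (Fin 3) → F} (hf : LocallyIntegrable f volume) (r : ℝ) {n : ℕ∞} :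
    ContDiff ℝ n (φ.normed volume ⋆[ContinuousLinearMap.lsmul ℝ ℝ, volume]
      (ball (0 : EuclideanSpace ℝ (Fin 3)) r).indicator f) :=
  φ.hasCompactSupport_normed.contDiff_convolution_left _ φ.contDiff_normed
    (hf.indicator measurableSet_ball)

/-- Every point of `B(0, R+1)` has its closed `rOut`-ball inside `B(0, R+2)` when `rOut ≤ 1`. [folklore] -/
theorem closedBall_subset_ball_of_mem {φr R : ℝ} (hφ : φr ≤ 1) {x : EuclideanSpace ℝ (Fin 3)}
    (hx : x ∈ ball (0 : EuclideanSpace ℝ (Fin 3)) (R + 1)) :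
    closedBall x φr ⊆ ball (0 : EuclideanSpace ℝ (Fin 3)) (R + 2) := by
  intro y hy
  rw [mem_closedBall, dist_eq_norm] at hy
  rw [mem_ball, dist_zero_right] at hx ⊢
  calc ‖y‖ = ‖(y - x) + x‖ := by abel_nf
    _ ≤ ‖y - x‖ + ‖x‖ := norm_add_le _ _
    _ < φr + (R + 1) := by linarith [hy]
    _ ≤ R + 2 := by linarith

/-- **Interior `L²` bound for the derivative of the mollification**: `‖D(φ ⋆ 𝟙_B V)‖_{L²(B(0,R+1))} ≤
‖G‖_{L²(B(0,R+2))}` for `rOut φ ≤ 1` (`HasWeakFDerivOn.eLpNorm_fderiv_normed_convolution_indicator_le`).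
[folklore] -/
theorem eLpNorm_fderiv_normed_convolution_indicator_ball_le
    (φ : ContDiffBump (0 : EuclideanSpace ℝ (Fin 3))) (hφ : φ.rOut ≤ 1)
    {V : EuclideanSpace ℝ (Fin 3) → EuclideanSpace ℝ (Fin 3)}
    {G : EuclideanSpace ℝ (Fin 3) → EuclideanSpace ℝ (Fin 3) →L[ℝ] EuclideanSpace ℝ (Fin 3)}
    (hVG : HasWeakFDerivOn (⊤ : Opens (EuclideanSpace ℝ (Fin 3))) volume V G) {R : ℝ}
    (hVi : IntegrableOn V (ball (0 : EuclideanSpace ℝ (Fin 3)) (R + 2)) volume)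
    (hGi : IntegrableOn G (ball (0 : EuclideanSpace ℝ (Fin 3)) (R + 2)) volume) :
    eLpNorm (fderiv ℝ (φ.normed volume ⋆[ContinuousLinearMap.lsmul ℝ ℝ, volume]
        (ball (0 : EuclideanSpace ℝ (Fin 3)) (R + 2)).indicator V)) 2
        (volume.restrict (ball (0 : EuclideanSpace ℝ (Fin 3)) (R + 1))) ≤
      eLpNorm G 2 (volume.restrict (ball (0 : EuclideanSpace ℝ (Fin 3)) (R + 2))) := by
  set U : Opens (EuclideanSpace ℝ (Fin 3)) := ⟨ball (0 : EuclideanSpace ℝ (Fin 3)) (R + 2), isOpen_ball⟩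
  have hU : HasWeakFDerivOn U volume V G := HasWeakFDerivOn.mono_set_holds hVG le_top
  exact hU.eLpNorm_fderiv_normed_convolution_indicator_le hVi hGi φ measurableSet_ball
    (fun x hx => closedBall_subset_ball_of_mem hφ hx) one_le_two

end Mollify



/-! ## Pointwise calculus helpers -/

section Calculus

/-- Product rule for a scalar function times a vector field (as a continuous linear map). [folklore] -/
theorem fderiv_smul_eq_of_differentiable {σ : EuclideanSpace ℝ (Fin 3) → ℝ}
    {W : EuclideanSpace ℝ (Fin 3) → EuclideanSpace ℝ (Fin 3)} (hσ : Differentiable ℝ σ)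
    (hW : Differentiable ℝ W) (x : EuclideanSpace ℝ (Fin 3)) :
    fderiv ℝ (fun y => σ y • W y) x = σ x • fderiv ℝ W x + (fderiv ℝ σ x).smulRight (W x) :=
  ((hσ x).hasFDerivAt.smul (hW x).hasFDerivAt).fderiv

/-- Product rule for a scalar function times a vector field, applied to a direction. [folklore] -/
theorem fderiv_smul_apply_of_differentiable {σ : EuclideanSpace ℝ (Fin 3) → ℝ}
    {W : EuclideanSpace ℝ (Fin 3) → EuclideanSpace ℝ (Fin 3)} (hσ : Differentiable ℝ σ)
    (hW : Differentiable ℝ W) (x v : EuclideanSpace ℝ (Fin 3)) :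
    fderiv ℝ (fun y => σ y • W y) x v = fderiv ℝ σ x v • W x + σ x • fderiv ℝ W x v := by
  rw [fderiv_smul_eq_of_differentiable hσ hW x]
  simp [add_comm]

/-- The divergence of `σ W`: `div (σ W) = Dσ(W) + σ div W`. [folklore] -/
theorem divergence_smul_of_differentiable {σ : EuclideanSpace ℝ (Fin 3) → ℝ}
    {W : EuclideanSpace ℝ (Fin 3) → EuclideanSpace ℝ (Fin 3)} (hσ : Differentiable ℝ σ)
    (hW : Differentiable ℝ W) (x : EuclideanSpace ℝ (Fin 3)) :
    VectorCalculus.divergence (fun y => σ y • W y) x =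
      fderiv ℝ σ x (W x) + σ x * VectorCalculus.divergence W x := by
  unfold VectorCalculus.divergence
  rw [fderiv_smul_eq_of_differentiable hσ hW x]
  simp [LinearMap.trace_smulRight, add_comm]

/-- Derivative of `½ σ |W|²` in a direction: `½ Dσ(v) |W|² + σ ⟪W, DW v⟫`. [folklore] -/
theorem fderiv_half_mul_norm_sq_apply {σ : EuclideanSpace ℝ (Fin 3) → ℝ}
    {W : EuclideanSpace ℝ (Fin 3) → EuclideanSpace ℝ (Fin 3)} (hσ : Differentiable ℝ σ)
    (hW : Differentiable ℝ W) (x v : EuclideanSpace ℝ (Fin 3)) :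
    fderiv ℝ (fun y => (1 / 2 : ℝ) * (σ y * ‖W y‖ ^ 2)) x v =
      (1 / 2 : ℝ) * (fderiv ℝ σ x v * ‖W x‖ ^ 2) + σ x * ⟪W x, fderiv ℝ W x v⟫ := by
  have hn : HasFDerivAt (fun y => ‖W y‖ ^ 2) (2 • (innerSL ℝ (W x)).comp (fderiv ℝ W x)) x :=
    (hW x).hasFDerivAt.norm_sq
  have h : HasFDerivAt (fun y => (1 / 2 : ℝ) * (σ y * ‖W y‖ ^ 2))
      ((1 / 2 : ℝ) • (σ x • (2 • (innerSL ℝ (W x)).comp (fderiv ℝ W x)) + ‖W x‖ ^ 2 • fderiv ℝ σ x)) x :=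
    ((hσ x).hasFDerivAt.mul hn).const_mul (1 / 2 : ℝ)
  rw [h.fderiv]
  simp
  ring

/-- `½ σ |W|²` is a test function when `σ` is one and `W` is smooth. [folklore] -/
theorem isTestFunctionOn_half_mul_norm_sq {σ : EuclideanSpace ℝ (Fin 3) → ℝ}
    {W : EuclideanSpace ℝ (Fin 3) → EuclideanSpace ℝ (Fin 3)}
    (hσ : IsTestFunctionOn (⊤ : Opens (EuclideanSpace ℝ (Fin 3))) σ) (hW : ContDiff ℝ ∞ W) :
    IsTestFunctionOn (⊤ : Opens (EuclideanSpace ℝ (Fin 3))) fun y => (1 / 2 : ℝ) * (σ y * ‖W y‖ ^ 2) where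
  contDiff := contDiff_const.mul (hσ.contDiff.mul (hW.norm_sq ℝ))
  hasCompactSupport := (hσ.hasCompactSupport.mul_right).mul_left
  tsupport_subset := by simp

/-- `σ • W` is a test field when `σ` is a test function and `W` is smooth. [folklore] -/
theorem isTestFunctionOn_smul {σ : EuclideanSpace ℝ (Fin 3) → ℝ}
    {W : EuclideanSpace ℝ (Fin 3) → EuclideanSpace ℝ (Fin 3)}
    (hσ : IsTestFunctionOn (⊤ : Opens (EuclideanSpace ℝ (Fin 3))) σ) (hW : ContDiff ℝ ∞ W) :
    IsTestFunctionOn (⊤ : Opens (EuclideanSpace ℝ (Fin 3))) fun y => σ y • W y where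
  contDiff := hσ.contDiff.smul hW
  hasCompactSupport := hσ.hasCompactSupport.smul_right
  tsupport_subset := by simp


/-- The divergence of a `C¹` field is continuous. [folklore] -/
theorem continuous_divergence_of_contDiff_one {X : EuclideanSpace ℝ (Fin 3) → EuclideanSpace ℝ (Fin 3)}
    (hX : ContDiff ℝ 1 X) : Continuous (VectorCalculus.divergence X) := by
  have h1 : Continuous (fderiv ℝ X) := hX.continuous_fderiv one_ne_zero
  have heq : VectorCalculus.divergence X = fun x => ∑ i, ⟪stdOrthonormalBasis ℝ (EuclideanSpace ℝ (Fin 3)) i,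
      fderiv ℝ X x (stdOrthonormalBasis ℝ (EuclideanSpace ℝ (Fin 3)) i)⟫ :=
    funext fun x => divergence_eq_sum_inner_fderiv (stdOrthonormalBasis ℝ (EuclideanSpace ℝ (Fin 3))) X x
  rw [heq]
  exact continuous_finsetSum _ fun i _ => continuous_const.inner (h1.clm_apply continuous_const)

/-- Measurability of `x ↦ A(x)(b(x))`. [folklore] -/
theorem aestronglyMeasurable_clm_apply {F : Type*} [NormedAddCommGroup F] [NormedSpace ℝ F]
    {A : EuclideanSpace ℝ (Fin 3) → EuclideanSpace ℝ (Fin 3) →L[ℝ] F}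
    {b : EuclideanSpace ℝ (Fin 3) → EuclideanSpace ℝ (Fin 3)} (hA : AEStronglyMeasurable A volume)
    (hb : AEStronglyMeasurable b volume) : AEStronglyMeasurable (fun x => A x (b x)) volume :=
  (isBoundedBilinearMap_apply (𝕜 := ℝ) (E := EuclideanSpace ℝ (Fin 3)) (F := F)).continuous.comp_aestronglyMeasurable
    (hA.prodMk hb)

/-- **Integrability from a bound on a set**: a measurable `f` vanishing off a measurable `K` and bounded
there by `C |q|` with `q ∈ L¹(K)` is integrable. [folklore] -/
theorem integrable_of_abs_le_on {f q : EuclideanSpace ℝ (Fin 3) → ℝ} {K : Set (EuclideanSpace ℝ (Fin 3))}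
    (hK : MeasurableSet K) (hfm : AEStronglyMeasurable f volume) (hq : IntegrableOn q K volume) {C : ℝ}
    (hf : ∀ x ∈ K, |f x| ≤ C * |q x|) (hf0 : ∀ x, x ∉ K → f x = 0) : Integrable f volume := by
  have hg : Integrable (fun x => C * ‖K.indicator q x‖) volume :=
    ((integrable_indicator_iff hK).2 hq).norm.const_mul C
  refine hg.mono' hfm (Eventually.of_forall fun x => ?_)
  by_cases hx : x ∈ K
  · rw [indicator_of_mem hx, Real.norm_eq_abs, Real.norm_eq_abs]; exact hf x hx
  · rw [hf0 x hx, indicator_of_notMem hx]; simp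

end Calculus



end ProfileEnergy

end Summit.NavierStokesRegularity.NavierStokesRegularity.Theorems.PowerGaugeEulerLiouville
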